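import Mathlib
import Summits.QuantumFields.YangMills.Theses.CoarseStiffnessTail
import Summits.QuantumFields.YangMills.Theorems.CoarseStiffnessTailHistoryTailOfStiffness

/-!
# Route `CoarseStiffnessTail` — the crux `CappedCoarseStiffnessL` (stmt-QuantumFields-25301) IN TAIL LANGUAGE:
# capped coarse stiffness ⇔ JOINT WINDOWED SUB-GAUSSIAN TAILS of the level-`j` averaged plaquette field (lead's certificate, seat `ym-line-cst-p1` g3)

KERNEL-CHECKED EQUIVALENCE (both directions, constants explicit).  Write `β = β_{K−j} = (γL^{−(K−j)})⁻¹`, `g = g_{K−j} = β^{−1/2}`,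
`d_a = |Ū^{j}(∂a) − 1|` (`dist1` of the `j`-fold averaged plaquette variable), `p = p(g_{K−j})` (so `βθBal(K−j)² = p²`,
`T3FinestHeightTail.beta_mul_θBal_sq`).  The crux says: `∫ exp(c₀·β·Σ_a min(d_a², θ²)) dGibbs_K ≤ e^{C₀·#Plaq_j}`.  The JOINT WINDOWED TAIL says:
for every threshold assignment `t : Plaq_j → [0, p²]`,

  `Gibbs_K{ ∀ a, t_a ≤ β·d_a² } ≤ e^{C·#Plaq_j} · exp(−c·Σ_a t_a)`,

i.e. `Gibbs_K{∀ a ∈ S, d_a ≥ s_a·g} ≤ e^{C#Plaq_j}·Π_{a∈S} e^{−c s_a²}` for all sub-families `S` (zero thresholds off `S`) and all `s_a ∈ [0, p]` — a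
multi-plaquette Gaussian tail at EVERY sub-threshold of Bałaban's small-field window, with a volume prefactor.
* `⇒` (`jointWindowTail_of_cappedCoarseStiffnessL`, constants kept): on the event, `t_a ≤ β·min(d_a², θ²)` for every `a` (because `t_a ≤ p² = βθ²`),
  so `Σ_a t_a ≤ β·X`, `X = Σ_a min(d_a², θ²)`; exponential Chebyshev (`measure_ge_le_exp_mul_mgf`) and the crux.
* `⇐` (`cappedCoarseStiffnessL_of_jointWindowTail`, `(c, C) ↦ (c₀, C₀) = (c/2, C + e^{c/2}/(1 − e^{−c/2}))`): the DISCRETISED LAYER-CAKE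
  EXPANSION `integral_exp_mul_sum_le_of_jointTail` (abstract, any finitely many bounded non-negative observables on a probability space):
  `e^{c₀y} ≤ Σ_{k ≤ N} e^{c₀(k+1)}·1{k ≤ y}` for `0 ≤ y ≤ M`, `N = ⌊M⌋` (the term `k = ⌊y⌋` alone dominates); multiply over the plaquettes and
  expand the product of sums into a sum over threshold assignments `κ : Plaq_j → {0,…,N}` (`Finset.sum_prod_piFinset`); each term is a constant
  times the indicator of a JOINT tail event, bounded by the hypothesis; re-factorise and sum the geometric series:
  `∫ e^{c₀ΣY} ≤ e^{C}·(e^{c₀}/(1 − e^{−(c−c₀)}))^{#Plaq_j}`.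
* `cappedCoarseStiffnessL_iff_jointWindowTail`: the equivalence.

USE (planners / disprover / instrument).  (1) The crux's content is located in the TAIL currency the sibling routes speak (`FirstExitWindow`,
`FibreConvexityTail`, `UnitScaleTilt`'s (α)/(71) record lines): it is EXACTLY a joint, volume-prefactored Gaussian tail of the averaged plaquette
deviations at ALL sub-thresholds `s ≤ p(g)` of the window — not only at the window edge `s = p(g)` where Bałaban's large-field factor
`e^{−p²/4}` ([Balaban1985UV3] (71) p.273) lives and where the filed tail cruxes 26243/25567/25568 are stated; the sub-threshold range `1 ≲ s < p(g)` is
small-field FLUCTUATION control (the level-`j` averaged field deviates by `O(g_{K−j})` jointly, with Gaussian tails), which is why the filed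
single-threshold tail cruxes do not imply the crux (the partial order of p625791 is strict as filed).  (2) An instrument row sharper than JOB A's free
energy: the joint tail at intermediate `s` (e.g. the homogeneous event `{∀ a ∈ S_ρ, d_a ≥ s g}` on a chessboard class) must decay like `e^{−cs²|S|}`
uniformly in `K` at fixed `j`.  (3) Any proof of the crux may equivalently deliver the joint tail (e.g. by a multi-plaquette chessboard / Peierls
argument at each threshold), and conversely.

HONEST SCOPE.  Soft measure theory and finite sums; NOTHING of Bałaban's estimates is proved; the crux `CappedCoarseStiffnessL` stays OPEN (its
registered skeleton's one open stub `stub_tiltedCappedMoment` ≡ the crux, p622921); no rung, leaf or summit is proved — `YM3TorusSU2` (rung R3, a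
RECORD rung, not the Clay statement) is NOT proved and the Yang–Mills mass gap is NOT touched.
References: T. Bałaban, CMP **102** (1985) 255–275 [Balaban1985UV3] ((7) p.257 thresholds, (71) p.273 large-field factor).
-/

noncomputable section

namespace Summit.QuantumFields.YangMills.Theorems.CoarseStiffnessTailJointWindowTail

open MeasureTheory ProbabilityTheory Finset
open Literature.MathematicalPhysics.QuantumFieldTheory
open Literature.MathematicalPhysics.QuantumFieldTheory.Balaban1983to89
open Literature.MathematicalPhysics.QuantumFieldTheory.Balaban1983to89.T3ContinuumYM3Torus
open Literature.MathematicalPhysics.QuantumFieldTheory.Balaban1983to89.T3UnitScaleTilt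
open Literature.MathematicalPhysics.QuantumFieldTheory.Balaban1983to89.T3UnitLawDensityEML
open Literature.MathematicalPhysics.QuantumFieldTheory.Balaban1983to89.T3FinestHeightTail (beta_mul_θBal_sq)
open Summit.QuantumFields.YangMills.Theorems.CoarseStiffnessTailHistoryTailOfStiffness (measurable_capSum capSum_mem)
open Summit.QuantumFields.YangMills.Theorems.LargeFieldMassRefinementTailSubGaussianRung (measurable_dist1_iter)

/-! ## §1 The discretised layer-cake expansion (abstract probability) -/

section Abstract

variable {Ω : Type*} [MeasurableSpace Ω] {ι : Type*} [Fintype ι]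

/-- One variable: for `0 ≤ y ≤ M` and `c₀ ≥ 0`, `e^{c₀y} ≤ Σ_{k ≤ ⌊M⌋} e^{c₀(k+1)}·1{k ≤ y}` — the single term `k = ⌊y⌋` already dominates
(`y < ⌊y⌋ + 1`), the others are non-negative. [folklore] -/
theorem exp_mul_le_sum_step {c₀ y M : ℝ} (hc₀ : 0 ≤ c₀) (hy : 0 ≤ y) (hyM : y ≤ M) :
    Real.exp (c₀ * y) ≤ ∑ k ∈ range (⌊M⌋₊ + 1),
      Real.exp (c₀ * ((k : ℝ) + 1)) * (if (k : ℝ) ≤ y then (1 : ℝ) else 0) := by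
  have hn : ⌊y⌋₊ ∈ range (⌊M⌋₊ + 1) := by
    rw [mem_range, Nat.lt_succ_iff]
    exact Nat.floor_le_floor hyM
  have hle : ((⌊y⌋₊ : ℕ) : ℝ) ≤ y := Nat.floor_le hy
  have hlt : y < ((⌊y⌋₊ : ℕ) : ℝ) + 1 := Nat.lt_floor_add_one y
  calc Real.exp (c₀ * y) ≤ Real.exp (c₀ * (((⌊y⌋₊ : ℕ) : ℝ) + 1)) :=
        Real.exp_le_exp.mpr (mul_le_mul_of_nonneg_left hlt.le hc₀)
    _ = Real.exp (c₀ * (((⌊y⌋₊ : ℕ) : ℝ) + 1)) * (if ((⌊y⌋₊ : ℕ) : ℝ) ≤ y then (1 : ℝ) else 0) := by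
        rw [if_pos hle, mul_one]
    _ ≤ ∑ k ∈ range (⌊M⌋₊ + 1), Real.exp (c₀ * ((k : ℝ) + 1)) * (if (k : ℝ) ≤ y then (1 : ℝ) else 0) :=
        single_le_sum (f := fun k : ℕ => Real.exp (c₀ * ((k : ℝ) + 1)) * (if (k : ℝ) ≤ y then (1 : ℝ) else 0))
          (fun k _ => mul_nonneg (Real.exp_pos _).le (by split_ifs <;> norm_num)) hn

/-- **DISCRETISED LAYER-CAKE EXPANSION** (joint tails ⇒ exponential moment of the sum).  On a probability space let `Y_a`, `a ∈ ι` finite, be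
measurable with `0 ≤ Y_a ≤ M`, and suppose the JOINT TAILS at integer thresholds are product-sub-exponential with a prefactor:
`μ{∀ a, k_a ≤ Y_a} ≤ e^{C}·exp(−c·Σ_a k_a)` for every `k : ι → ℕ` with `k_a ≤ M`.  Then for `0 < c₀ < c`:
`∫ exp(c₀·Σ_a Y_a) dμ ≤ e^{C}·(e^{c₀}/(1 − e^{−(c−c₀)}))^{|ι|}`.  Proof: `exp_mul_le_sum_step` per variable, product of sums = sum over threshold
assignments `κ : ι → {0,…,⌊M⌋}` of products (`Finset.sum_prod_piFinset`), each product = constant × indicator of the joint event `{∀ a, κ_a ≤ Y_a}`,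
integrate, bound by the hypothesis, re-factorise, geometric series. [folklore] -/
theorem integral_exp_mul_sum_le_of_jointTail (μ : Measure Ω) [IsProbabilityMeasure μ] {Y : ι → Ω → ℝ}
    (hYm : ∀ a, Measurable (Y a)) {M : ℝ} (hM : 0 ≤ M) (hY0 : ∀ a ω, 0 ≤ Y a ω) (hYM : ∀ a ω, Y a ω ≤ M)
    {c₀ c C : ℝ} (hc₀ : 0 < c₀) (hc : c₀ < c)
    (htail : ∀ k : ι → ℕ, (∀ a, (k a : ℝ) ≤ M) →
      μ.real {ω | ∀ a, (k a : ℝ) ≤ Y a ω} ≤ Real.exp C * Real.exp (-(c * ∑ a, (k a : ℝ)))) :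
    ∫ ω, Real.exp (c₀ * ∑ a, Y a ω) ∂μ ≤
      Real.exp C * (Real.exp c₀ / (1 - Real.exp (-(c - c₀)))) ^ Fintype.card ι := by
  classical
  -- (1) pointwise expansion into a sum over threshold assignments
  have hpt : ∀ ω, Real.exp (c₀ * ∑ a, Y a ω) ≤
      ∑ κ ∈ Fintype.piFinset (fun _ : ι => range (⌊M⌋₊ + 1)),
        ∏ a, (Real.exp (c₀ * ((κ a : ℝ) + 1)) * (if ((κ a : ℕ) : ℝ) ≤ Y a ω then (1 : ℝ) else 0)) := by
    intro ω
    calc Real.exp (c₀ * ∑ a, Y a ω) = ∏ a, Real.exp (c₀ * Y a ω) := by rw [mul_sum, Real.exp_sum]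
      _ ≤ ∏ a, ∑ k ∈ range (⌊M⌋₊ + 1),
            Real.exp (c₀ * ((k : ℝ) + 1)) * (if (k : ℝ) ≤ Y a ω then (1 : ℝ) else 0) :=
          prod_le_prod (fun a _ => (Real.exp_pos _).le)
            (fun a _ => exp_mul_le_sum_step hc₀.le (hY0 a ω) (hYM a ω))
      _ = ∑ κ ∈ Fintype.piFinset (fun _ : ι => range (⌊M⌋₊ + 1)),
            ∏ a, (Real.exp (c₀ * ((κ a : ℝ) + 1)) * (if ((κ a : ℕ) : ℝ) ≤ Y a ω then (1 : ℝ) else 0)) :=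
          (Finset.sum_prod_piFinset (range (⌊M⌋₊ + 1))
            (fun a (k : ℕ) => Real.exp (c₀ * ((k : ℝ) + 1)) * (if (k : ℝ) ≤ Y a ω then (1 : ℝ) else 0))).symm
  -- (2) each term is a constant times the indicator of a joint tail event
  have hterm : ∀ κ : ι → ℕ,
      (fun ω => ∏ a, (Real.exp (c₀ * ((κ a : ℝ) + 1)) * (if ((κ a : ℕ) : ℝ) ≤ Y a ω then (1 : ℝ) else 0))) =
        fun ω => (∏ a, Real.exp (c₀ * ((κ a : ℝ) + 1))) *
          Set.indicator {ω | ∀ a, ((κ a : ℕ) : ℝ) ≤ Y a ω} (fun _ => (1 : ℝ)) ω := by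
    intro κ
    funext ω
    rw [prod_mul_distrib, Fintype.prod_boole]
    by_cases h : ∀ a, ((κ a : ℕ) : ℝ) ≤ Y a ω
    · rw [if_pos h, Set.indicator_of_mem (show ω ∈ {ω | ∀ a, ((κ a : ℕ) : ℝ) ≤ Y a ω} from h)]
    · rw [if_neg h, Set.indicator_of_notMem (show ω ∉ {ω | ∀ a, ((κ a : ℕ) : ℝ) ≤ Y a ω} from h)]
  have hE : ∀ κ : ι → ℕ, MeasurableSet {ω | ∀ a, ((κ a : ℕ) : ℝ) ≤ Y a ω} := by
    intro κ
    have : {ω | ∀ a, ((κ a : ℕ) : ℝ) ≤ Y a ω} = ⋂ a, {ω | ((κ a : ℕ) : ℝ) ≤ Y a ω} := by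
      ext ω
      simp only [Set.mem_setOf_eq, Set.mem_iInter]
    rw [this]
    exact MeasurableSet.iInter fun a => measurableSet_le measurable_const (hYm a)
  have hTint : ∀ κ : ι → ℕ, Integrable (fun ω => ∏ a, (Real.exp (c₀ * ((κ a : ℝ) + 1)) *
      (if ((κ a : ℕ) : ℝ) ≤ Y a ω then (1 : ℝ) else 0))) μ := by
    intro κ
    rw [hterm κ]
    exact ((integrable_const (1 : ℝ)).indicator (hE κ)).const_mul _
  have hTI : ∀ κ : ι → ℕ, ∫ ω, ∏ a, (Real.exp (c₀ * ((κ a : ℝ) + 1)) *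
      (if ((κ a : ℕ) : ℝ) ≤ Y a ω then (1 : ℝ) else 0)) ∂μ =
        (∏ a, Real.exp (c₀ * ((κ a : ℝ) + 1))) * μ.real {ω | ∀ a, ((κ a : ℕ) : ℝ) ≤ Y a ω} := by
    intro κ
    rw [hterm κ, integral_const_mul, integral_indicator_const _ (hE κ), smul_eq_mul, mul_one]
  -- (3) integrability of the left-hand side (bounded by `exp(c₀·|ι|·M)`)
  have hLint : Integrable (fun ω => Real.exp (c₀ * ∑ a, Y a ω)) μ := by
    have hmeas : Measurable fun ω => Real.exp (c₀ * ∑ a, Y a ω) :=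
      Real.measurable_exp.comp ((Finset.measurable_sum _ fun a _ => hYm a).const_mul c₀)
    refine (integrable_const (Real.exp (c₀ * ((Fintype.card ι : ℝ) * M)))).mono' hmeas.aestronglyMeasurable
      (ae_of_all _ fun ω => ?_)
    rw [Real.norm_eq_abs, abs_of_pos (Real.exp_pos _)]
    refine Real.exp_le_exp.mpr (mul_le_mul_of_nonneg_left ?_ hc₀.le)
    calc ∑ a, Y a ω ≤ ∑ _a : ι, M := sum_le_sum fun a _ => hYM a ω
      _ = (Fintype.card ι : ℝ) * M := by rw [sum_const, card_univ, nsmul_eq_mul]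
  -- (4) the geometric ratio
  have hr0 : 0 < Real.exp (-(c - c₀)) := Real.exp_pos _
  have hr1 : Real.exp (-(c - c₀)) < 1 := Real.exp_lt_one_iff.mpr (by linarith)
  -- (5) the chain
  calc ∫ ω, Real.exp (c₀ * ∑ a, Y a ω) ∂μ
      ≤ ∫ ω, ∑ κ ∈ Fintype.piFinset (fun _ : ι => range (⌊M⌋₊ + 1)),
          ∏ a, (Real.exp (c₀ * ((κ a : ℝ) + 1)) * (if ((κ a : ℕ) : ℝ) ≤ Y a ω then (1 : ℝ) else 0)) ∂μ :=
        integral_mono hLint (integrable_finsetSum _ fun κ _ => hTint κ) hpt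
    _ = ∑ κ ∈ Fintype.piFinset (fun _ : ι => range (⌊M⌋₊ + 1)),
          (∏ a, Real.exp (c₀ * ((κ a : ℝ) + 1))) * μ.real {ω | ∀ a, ((κ a : ℕ) : ℝ) ≤ Y a ω} := by
        rw [integral_finsetSum _ fun κ _ => hTint κ]
        exact sum_congr rfl fun κ _ => hTI κ
    _ ≤ ∑ κ ∈ Fintype.piFinset (fun _ : ι => range (⌊M⌋₊ + 1)),
          (∏ a, Real.exp (c₀ * ((κ a : ℝ) + 1))) * (Real.exp C * Real.exp (-(c * ∑ a, ((κ a : ℕ) : ℝ)))) := by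
        refine sum_le_sum fun κ hκ => mul_le_mul_of_nonneg_left (htail κ fun a => ?_)
          (prod_nonneg fun a _ => (Real.exp_pos _).le)
        have hk : κ a ∈ range (⌊M⌋₊ + 1) := Fintype.mem_piFinset.mp hκ a
        rw [mem_range, Nat.lt_succ_iff] at hk
        exact (Nat.cast_le.mpr hk).trans (Nat.floor_le hM)
    _ = Real.exp C * ∑ κ ∈ Fintype.piFinset (fun _ : ι => range (⌊M⌋₊ + 1)),
          ∏ a, (Real.exp c₀ * Real.exp (-(c - c₀)) ^ (κ a)) := by
        rw [mul_sum]
        refine sum_congr rfl fun κ _ => ?_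
        rw [mul_sum, ← sum_neg_distrib, Real.exp_sum, mul_left_comm, ← prod_mul_distrib]
        refine congrArg _ (prod_congr rfl fun a _ => ?_)
        rw [← Real.exp_nat_mul, ← Real.exp_add, ← Real.exp_add]
        congr 1
        ring
    _ = Real.exp C * (∑ k ∈ range (⌊M⌋₊ + 1), Real.exp c₀ * Real.exp (-(c - c₀)) ^ k) ^ Fintype.card ι := by
        rw [Finset.sum_prod_piFinset (range (⌊M⌋₊ + 1)) (fun (_ : ι) (k : ℕ) => Real.exp c₀ * Real.exp (-(c - c₀)) ^ k),
          prod_const, card_univ]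
    _ ≤ Real.exp C * (Real.exp c₀ / (1 - Real.exp (-(c - c₀)))) ^ Fintype.card ι := by
        refine mul_le_mul_of_nonneg_left ?_ (Real.exp_pos _).le
        refine pow_le_pow_left₀ (sum_nonneg fun k _ => by positivity) ?_ _
        rw [← mul_sum, div_eq_mul_inv]
        refine mul_le_mul_of_nonneg_left ?_ (Real.exp_pos _).le
        have hgeom := geom_sum_Ico_le_of_lt_one (m := 0) (n := ⌊M⌋₊ + 1) hr0.le hr1
        rw [pow_zero, one_div, ← range_eq_Ico] at hgeom
        exact hgeom

end Abstract

/-! ## §2 The crux implies the joint windowed tail (exponential Chebyshev) -/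

/-- **`CappedCoarseStiffnessL ⇒` JOINT WINDOWED TAIL** (constants kept: `(c, C, γ₁) = (c₀, C₀, γ₁)`): for every threshold assignment
`t : Plaq_j → [0, p(g_{K−j})²]`, `Gibbs_K{∀ a, t_a ≤ β_{K−j}·|Ū^j(∂a) − 1|²} ≤ e^{C₀#Plaq_j}·exp(−c₀Σ_a t_a)`.  On the event `t_a ≤ β·min(d_a², θ²)` for
every `a` (as `t_a ≤ p² = βθ²`, `beta_mul_θBal_sq`), hence `Σ_a t_a ≤ β·Σ_a min(d_a², θ²)`; exponential Chebyshev (`measure_ge_le_exp_mul_mgf` at the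
parameter `c₀β`) and the crux.  Conditional certificate; the crux stays OPEN. [cite: Balaban1985UV3, (7) p.257 and (71) p.273] -/
theorem jointWindowTail_of_cappedCoarseStiffnessL
    (h : Summit.QuantumFields.YangMills.Theses.CoarseStiffnessTail.CappedCoarseStiffnessL) :
    ∀ (L : ℕ) (b₀ p₀ : ℝ), 0 < b₀ → 2 < p₀ → ∃ (c C γ₁ : ℝ), 0 < c ∧ 0 < γ₁ ∧ γ₁ ≤ 1 ∧
      ∀ (F : T3Family) (γ : ℝ), F.L = L → 0 < γ → γ ≤ γ₁ → ∀ (K j : ℕ), j ≤ K →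
        ∀ t : Plaq (F.P K) j → ℝ,
          (∀ a, 0 ≤ t a ∧ t a ≤ B10.pFun b₀ p₀ (Real.sqrt (γ * ((F.L : ℝ)⁻¹) ^ (K - j))) ^ 2) →
          (gibbsK F ℰp γ K).real {U | ∀ a, t a ≤ (γ * ((F.L : ℝ)⁻¹) ^ (K - j))⁻¹ *
              GaugeGroup.dist1 (GaugeField.plaqHol
                (Averaging.iter (fun i => BlockAveraging.blockAvg (P := F.P K) (j := i) ℰp) j U) a) ^ 2} ≤
            Real.exp (C * (Fintype.card (Plaq (F.P K) j) : ℝ)) * Real.exp (-(c * ∑ a, t a)) := by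
  intro L b₀ p₀ hb₀ hp₀
  obtain ⟨c₀, C₀, γ₁, hc₀, hγ₁, hγ₁1, hbound⟩ := h L b₀ p₀ hb₀ hp₀
  refine ⟨c₀, C₀, γ₁, hc₀, hγ₁, hγ₁1, fun F γ hFL hγ hγγ₁ K j hjK t ht => ?_⟩
  haveI := isProbabilityMeasure_gibbsK F ℰp hγ.le K
  have hL0 : (0 : ℝ) < F.L := by exact_mod_cast (zero_lt_one.trans F.hL.2)
  set B : ℝ := (γ * ((F.L : ℝ)⁻¹) ^ (K - j))⁻¹ with hBdef
  have hB0 : 0 < B := by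
    rw [hBdef]
    exact inv_pos.mpr (mul_pos hγ (pow_pos (inv_pos.mpr hL0) _))
  set θ : ℝ := θBal F.L γ b₀ p₀ (K - j) with hθdef
  have hBθ : B * θ ^ 2 = B10.pFun b₀ p₀ (Real.sqrt (γ * ((F.L : ℝ)⁻¹) ^ (K - j))) ^ 2 :=
    beta_mul_θBal_sq F hγ b₀ p₀ (K - j)
  -- the capped observable `X = Σ_a min(d_a², θ²)`
  set X : GaugeField (F.P K) 0 (Matrix.specialUnitaryGroup (Fin 2) ℂ) → ℝ := fun U =>
    ∑ a : Plaq (F.P K) j, min (GaugeGroup.dist1 (GaugeField.plaqHol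
      (Averaging.iter (fun i => BlockAveraging.blockAvg (P := F.P K) (j := i) ℰp) j U) a) ^ 2) (θ ^ 2) with hXdef
  -- the event lies in `{(Σ t)/B ≤ X}`
  have hsub : {U : GaugeField (F.P K) 0 (Matrix.specialUnitaryGroup (Fin 2) ℂ) | ∀ a, t a ≤ B *
        GaugeGroup.dist1 (GaugeField.plaqHol
          (Averaging.iter (fun i => BlockAveraging.blockAvg (P := F.P K) (j := i) ℰp) j U) a) ^ 2} ⊆
      {U | (∑ a, t a) / B ≤ X U} := by
    intro U hU
    have hU' : ∀ a, t a ≤ B * GaugeGroup.dist1 (GaugeField.plaqHol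
        (Averaging.iter (fun i => BlockAveraging.blockAvg (P := F.P K) (j := i) ℰp) j U) a) ^ 2 := hU
    rw [Set.mem_setOf_eq, div_le_iff₀ hB0, hXdef]
    show ∑ a, t a ≤ (∑ a : Plaq (F.P K) j, min (GaugeGroup.dist1 (GaugeField.plaqHol
      (Averaging.iter (fun i => BlockAveraging.blockAvg (P := F.P K) (j := i) ℰp) j U) a) ^ 2) (θ ^ 2)) * B
    rw [sum_mul]
    refine sum_le_sum fun a _ => ?_
    have h2 : t a ≤ B * θ ^ 2 := by rw [hBθ]; exact (ht a).2
    calc t a ≤ min (B * GaugeGroup.dist1 (GaugeField.plaqHol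
          (Averaging.iter (fun i => BlockAveraging.blockAvg (P := F.P K) (j := i) ℰp) j U) a) ^ 2) (B * θ ^ 2) :=
        le_min (hU' a) h2
      _ = min (GaugeGroup.dist1 (GaugeField.plaqHol
          (Averaging.iter (fun i => BlockAveraging.blockAvg (P := F.P K) (j := i) ℰp) j U) a) ^ 2) (θ ^ 2) * B := by
        rw [← mul_min_of_nonneg _ _ hB0.le, mul_comm]
  -- integrability of `exp((c₀B)·X)` (bounded by `exp((c₀B)·#Plaq_j·θ²)`)
  have hint : Integrable (fun U => Real.exp ((c₀ * B) * X U)) (gibbsK F ℰp γ K) := by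
    have hmeas : Measurable fun U => Real.exp ((c₀ * B) * X U) :=
      Real.measurable_exp.comp ((measurable_capSum F K j θ).const_mul (c₀ * B))
    refine (integrable_const (Real.exp ((c₀ * B) * ((Fintype.card (Plaq (F.P K) j) : ℝ) * θ ^ 2)))).mono'
      hmeas.aestronglyMeasurable (ae_of_all _ fun U => ?_)
    rw [Real.norm_eq_abs, abs_of_pos (Real.exp_pos _)]
    exact Real.exp_le_exp.mpr (mul_le_mul_of_nonneg_left (capSum_mem F K j θ U).2 (mul_pos hc₀ hB0).le)
  -- the crux bounds the moment generating function
  have hmgf : mgf X (gibbsK F ℰp γ K) (c₀ * B) ≤ Real.exp (C₀ * (Fintype.card (Plaq (F.P K) j) : ℝ)) := by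
    have h := hbound F γ hFL hγ hγγ₁ K j hjK
    simp only [mgf]
    convert h using 4
  -- exponential Chebyshev
  have hcheb := measure_ge_le_exp_mul_mgf (μ := gibbsK F ℰp γ K) (X := X) ((∑ a, t a) / B) (mul_pos hc₀ hB0).le hint
  calc (gibbsK F ℰp γ K).real {U | ∀ a, t a ≤ B * GaugeGroup.dist1 (GaugeField.plaqHol
          (Averaging.iter (fun i => BlockAveraging.blockAvg (P := F.P K) (j := i) ℰp) j U) a) ^ 2}
      ≤ (gibbsK F ℰp γ K).real {U | (∑ a, t a) / B ≤ X U} := measureReal_mono hsub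
    _ ≤ Real.exp (-(c₀ * B) * ((∑ a, t a) / B)) * mgf X (gibbsK F ℰp γ K) (c₀ * B) := hcheb
    _ ≤ Real.exp (-(c₀ * B) * ((∑ a, t a) / B)) * Real.exp (C₀ * (Fintype.card (Plaq (F.P K) j) : ℝ)) :=
        mul_le_mul_of_nonneg_left hmgf (Real.exp_pos _).le
    _ = Real.exp (C₀ * (Fintype.card (Plaq (F.P K) j) : ℝ)) * Real.exp (-(c₀ * ∑ a, t a)) := by
        rw [mul_comm]
        congr 2
        field_simp

/-! ## §3 The joint windowed tail implies the crux (discretised layer cake) -/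

/-- **JOINT WINDOWED TAIL `⇒ CappedCoarseStiffnessL`** (`(c, C) ↦ (c₀, C₀) = (c/2, C + e^{c/2}/(1 − e^{−c/2}))`, same `γ₁`): apply
`integral_exp_mul_sum_le_of_jointTail` to `Y_a = β·min(d_a², θ²) ∈ [0, βθ²] = [0, p²]` under `Gibbs_K`; its integer-threshold joint events
`{∀ a, k_a ≤ Y_a}` are sub-events of `{∀ a, k_a ≤ β d_a²}` (with `k_a ≤ p²`), bounded by the hypothesis; finally
`A^{#Plaq_j} ≤ e^{A·#Plaq_j}` (`A = e^{c/2}/(1 − e^{−c/2}) ≥ 0`).  Conditional certificate; the crux stays OPEN. [cite: Balaban1985UV3, (7) p.257 and (71) p.273] -/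
theorem cappedCoarseStiffnessL_of_jointWindowTail
    (h : ∀ (L : ℕ) (b₀ p₀ : ℝ), 0 < b₀ → 2 < p₀ → ∃ (c C γ₁ : ℝ), 0 < c ∧ 0 < γ₁ ∧ γ₁ ≤ 1 ∧
      ∀ (F : T3Family) (γ : ℝ), F.L = L → 0 < γ → γ ≤ γ₁ → ∀ (K j : ℕ), j ≤ K →
        ∀ t : Plaq (F.P K) j → ℝ,
          (∀ a, 0 ≤ t a ∧ t a ≤ B10.pFun b₀ p₀ (Real.sqrt (γ * ((F.L : ℝ)⁻¹) ^ (K - j))) ^ 2) →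
          (gibbsK F ℰp γ K).real {U | ∀ a, t a ≤ (γ * ((F.L : ℝ)⁻¹) ^ (K - j))⁻¹ *
              GaugeGroup.dist1 (GaugeField.plaqHol
                (Averaging.iter (fun i => BlockAveraging.blockAvg (P := F.P K) (j := i) ℰp) j U) a) ^ 2} ≤
            Real.exp (C * (Fintype.card (Plaq (F.P K) j) : ℝ)) * Real.exp (-(c * ∑ a, t a))) :
    Summit.QuantumFields.YangMills.Theses.CoarseStiffnessTail.CappedCoarseStiffnessL := by
  intro L b₀ p₀ hb₀ hp₀
  obtain ⟨c, C, γ₁, hc, hγ₁, hγ₁1, htail⟩ := h L b₀ p₀ hb₀ hp₀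
  refine ⟨c / 2, C + Real.exp (c / 2) / (1 - Real.exp (-(c / 2))), γ₁, half_pos hc, hγ₁, hγ₁1,
    fun F γ hFL hγ hγγ₁ K j hjK => ?_⟩
  haveI := isProbabilityMeasure_gibbsK F ℰp hγ.le K
  have hL0 : (0 : ℝ) < F.L := by exact_mod_cast (zero_lt_one.trans F.hL.2)
  set B : ℝ := (γ * ((F.L : ℝ)⁻¹) ^ (K - j))⁻¹ with hBdef
  have hB0 : 0 < B := by
    rw [hBdef]
    exact inv_pos.mpr (mul_pos hγ (pow_pos (inv_pos.mpr hL0) _))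
  set θ : ℝ := θBal F.L γ b₀ p₀ (K - j) with hθdef
  have hBθ : B * θ ^ 2 = B10.pFun b₀ p₀ (Real.sqrt (γ * ((F.L : ℝ)⁻¹) ^ (K - j))) ^ 2 :=
    beta_mul_θBal_sq F hγ b₀ p₀ (K - j)
  -- the abstract expansion for `Y_a = B·min(d_a², θ²)`, `M = Bθ²`, `c₀ = c/2`
  have key := integral_exp_mul_sum_le_of_jointTail (gibbsK F ℰp γ K)
    (Y := fun (a : Plaq (F.P K) j) (U : GaugeField (F.P K) 0 (Matrix.specialUnitaryGroup (Fin 2) ℂ)) =>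
      B * min (GaugeGroup.dist1 (GaugeField.plaqHol
        (Averaging.iter (fun i => BlockAveraging.blockAvg (P := F.P K) (j := i) ℰp) j U) a) ^ 2) (θ ^ 2))
    (fun a => (((measurable_dist1_iter F K j a).pow_const 2).min measurable_const).const_mul B)
    (M := B * θ ^ 2) (by positivity)
    (fun a U => mul_nonneg hB0.le (le_min (sq_nonneg _) (sq_nonneg _)))
    (fun a U => mul_le_mul_of_nonneg_left (min_le_right _ _) hB0.le)
    (c₀ := c / 2) (c := c) (C := C * (Fintype.card (Plaq (F.P K) j) : ℝ)) (half_pos hc) (by linarith)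
    (fun k hk => by
      refine (measureReal_mono (fun U hU a => ?_)).trans
        (htail F γ hFL hγ hγγ₁ K j hjK (fun a => (k a : ℝ)) fun a => ⟨Nat.cast_nonneg _, ?_⟩)
      · have hU' : ∀ a, (k a : ℝ) ≤ B * min (GaugeGroup.dist1 (GaugeField.plaqHol
            (Averaging.iter (fun i => BlockAveraging.blockAvg (P := F.P K) (j := i) ℰp) j U) a) ^ 2) (θ ^ 2) := hU
        exact (hU' a).trans (mul_le_mul_of_nonneg_left (min_le_left _ _) hB0.le)
      · rw [← hBθ]
        exact hk a)
  have hcc : c - c / 2 = c / 2 := by ring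
  rw [hcc] at key
  set A : ℝ := Real.exp (c / 2) / (1 - Real.exp (-(c / 2))) with hAdef
  have hA0 : 0 ≤ A := by
    rw [hAdef]
    exact div_nonneg (Real.exp_pos _).le (sub_nonneg.mpr (Real.exp_le_one_iff.mpr (by linarith)))
  have hApow : A ^ Fintype.card (Plaq (F.P K) j) ≤ Real.exp (A * (Fintype.card (Plaq (F.P K) j) : ℝ)) := by
    calc A ^ Fintype.card (Plaq (F.P K) j) ≤ Real.exp A ^ Fintype.card (Plaq (F.P K) j) :=
          pow_le_pow_left₀ hA0 (by linarith [Real.add_one_le_exp A]) _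
      _ = Real.exp (A * (Fintype.card (Plaq (F.P K) j) : ℝ)) := by
          rw [← Real.exp_nat_mul, mul_comm]
  -- the crux's integrand is `exp((c/2)·Σ_a Y_a)`
  have hEq : ∫ U, Real.exp (c / 2 * B * ∑ a : Plaq (F.P K) j, min (GaugeGroup.dist1 (GaugeField.plaqHol
        (Averaging.iter (fun i => BlockAveraging.blockAvg (P := F.P K) (j := i) ℰp) j U) a) ^ 2) (θ ^ 2))
        ∂(gibbsK F ℰp γ K) =
      ∫ U, Real.exp (c / 2 * ∑ a : Plaq (F.P K) j, B * min (GaugeGroup.dist1 (GaugeField.plaqHol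
        (Averaging.iter (fun i => BlockAveraging.blockAvg (P := F.P K) (j := i) ℰp) j U) a) ^ 2) (θ ^ 2))
        ∂(gibbsK F ℰp γ K) := by
    refine integral_congr_ae (ae_of_all _ fun U => ?_)
    simp only
    rw [mul_assoc, mul_sum]
  rw [hEq]
  calc ∫ U, Real.exp (c / 2 * ∑ a : Plaq (F.P K) j, B * min (GaugeGroup.dist1 (GaugeField.plaqHol
        (Averaging.iter (fun i => BlockAveraging.blockAvg (P := F.P K) (j := i) ℰp) j U) a) ^ 2) (θ ^ 2))
        ∂(gibbsK F ℰp γ K)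
      ≤ Real.exp (C * (Fintype.card (Plaq (F.P K) j) : ℝ)) * A ^ Fintype.card (Plaq (F.P K) j) := key
    _ ≤ Real.exp (C * (Fintype.card (Plaq (F.P K) j) : ℝ)) * Real.exp (A * (Fintype.card (Plaq (F.P K) j) : ℝ)) :=
        mul_le_mul_of_nonneg_left hApow (Real.exp_pos _).le
    _ = Real.exp ((C + A) * (Fintype.card (Plaq (F.P K) j) : ℝ)) := by
        rw [← Real.exp_add]
        congr 1
        ring

/-! ## §4 The equivalence -/

/-- **`CappedCoarseStiffnessL ⇔` JOINT WINDOWED SUB-GAUSSIAN TAILS** of the level-`j` averaged plaquette deviations at all sub-thresholds of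
Bałaban's small-field window (`jointWindowTail_of_cappedCoarseStiffnessL` and `cappedCoarseStiffnessL_of_jointWindowTail`).  Staffing reading: the
crux (one tilted partition function per RG level) and the joint multi-threshold tail family are the SAME obligation up to constants; the filed
single-threshold tail cruxes (26243, 25567, 25568) sit strictly below as filed.  Nothing of Bałaban is proved; the crux stays OPEN.
[cite: Balaban1985UV3, (7) p.257 and (71) p.273] -/
theorem cappedCoarseStiffnessL_iff_jointWindowTail :
    Summit.QuantumFields.YangMills.Theses.CoarseStiffnessTail.CappedCoarseStiffnessL ↔
    ∀ (L : ℕ) (b₀ p₀ : ℝ), 0 < b₀ → 2 < p₀ → ∃ (c C γ₁ : ℝ), 0 < c ∧ 0 < γ₁ ∧ γ₁ ≤ 1 ∧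
      ∀ (F : T3Family) (γ : ℝ), F.L = L → 0 < γ → γ ≤ γ₁ → ∀ (K j : ℕ), j ≤ K →
        ∀ t : Plaq (F.P K) j → ℝ,
          (∀ a, 0 ≤ t a ∧ t a ≤ B10.pFun b₀ p₀ (Real.sqrt (γ * ((F.L : ℝ)⁻¹) ^ (K - j))) ^ 2) →
          (gibbsK F ℰp γ K).real {U | ∀ a, t a ≤ (γ * ((F.L : ℝ)⁻¹) ^ (K - j))⁻¹ *
              GaugeGroup.dist1 (GaugeField.plaqHol
                (Averaging.iter (fun i => BlockAveraging.blockAvg (P := F.P K) (j := i) ℰp) j U) a) ^ 2} ≤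
            Real.exp (C * (Fintype.card (Plaq (F.P K) j) : ℝ)) * Real.exp (-(c * ∑ a, t a)) :=
  ⟨jointWindowTail_of_cappedCoarseStiffnessL, cappedCoarseStiffnessL_of_jointWindowTail⟩

end Summit.QuantumFields.YangMills.Theorems.CoarseStiffnessTailJointWindowTail

end
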